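import Summits.QuantumFields.YangMills.Theorems.BalabanUVNodesN27RatesHolderAtKernelPinnedReading
import Summits.QuantumFields.YangMills.Theorems.BalabanUVNodesN27AtKernelPinnedReading13CoPHLetters
import Summits.QuantumFields.YangMills.Theorems.BalabanUVNodesN19CoreEdgeFSCComposer
import Summits.QuantumFields.YangMills.Theorems.BalabanUVNodesN14AtTopBornTower
import Summits.QuantumFields.YangMills.Theorems.BalabanUVNodesN15AtReadingOfRecord13CoPHC2Bg

/-!
# BalabanUVNodes ∕ N27 = binder B5 AT THE RECORD — module (Kꜰ): THE K3⁷ REDUCTION AT A KERNEL-PINNED STAGE-13 RATE READING **IN THE SKELETON v4 (17c74fac127b5f61) FULL-PREFIX KEYING**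
# (plan g82 YMPLAN-G82-K3V4-REGISTERED l.27703, (t9)∕№204): the reading-layer rows (N14 on `𝔯.ne1`, N15 ∕ N16-at-β on the selected layers of `𝔯.lit`) are asked ONLY for the TUNED small-coupling
# sequences under (B) ∧ endpoint existence — `∀ F θ hP, G θ → θ.Admissible F N → (B) → END → ForSmallCouplings (datumOfRecord₁₃CoPH F N θ hP) fun g₀ => ∀ os, …` — exactly v4's
# `KeyedRatesHolderD4 β (rrOfRecord 𝔯 ksel)` prefix, at the selector `ksel`; the three U3 rows stay TUPLE-LEVEL kernel rows (they do not read `g₀`): (D4) ⟸ (5.10) + letter inequalities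
# (this seat's g0 p591653), N18 ∕ N22 at the kernel bundle (θ-form) or read off def-W1's four finite-volume letters ((Kᴸ) §1), N17 by the U3 → U2 edge; the N19′ face `h19` under the same
# prefix at `P := PHolderD4 β` SPELLED (`RatesHolderAt D R β ∧ ReadOutAt D R.u3 ∧ (0 ≤ R.u3.ρ ∧ R.u3.ρ < 1)`); N20 ∕ N21 ∀-keyed; `hx` as ever — composed by dag-n19-w3's
# `keyedGuarded₁₃CoPH_of_keyedFacesP_fsc` (`…N19CoreEdgeFSCComposer` p595910, the composer v4's `SpineGivenEndpointR13SepCoPH_of` applies) with the P-body supplied per tuple by (Kᴿ) §1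
# (cell `pub-ymgap`, HUMAN RULING D-0062 Track A; director-ym №197 ∕ HUMAN RULING D-0149; width seat `pub-ymgap-dag-n27-w1` gen 2 on NODE n27 (B5 composite); K3⁷
# `SpineGivenEndpointR13SepCoPH` = stmt-QuantumFields-20544, `--kind proof --supports 20544 --as helper`; COUNT-NEUTRAL; THEOREMS ONLY, 0 `def`, 0 `sorry`; `N`-generic, guard-generic, NO Theses
# import, does NOT import the skeleton (its `PHolderD4 ∕ KeyedRatesHolderD4 ∕ rrOfRecord` are spelled); the conclusion `HybridNE7Under (datumOfRecord₁₃CoPH F N θ hP) END` per guarded admissible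
# tuple IS the item's body at `N = 2`, `G :=` guard, `hP := h.toCore` — the one-line leaf is dag-n27-c's to file (dag-lead DEDUP-372 §n27 ownership note v60))

WHAT IS KERNEL-CHECKED ([bookkeeping]).
* §1 ONE TUPLE: `pHolderD4Body_rateCarriers_of_kernels_pin` — v4's `PHolderD4 β D R` BODY `RatesHolderAt D R β ∧ ReadOutAt D R.u3 ∧ (0 ≤ R.u3.ρ ∧ R.u3.ρ < 1)` at
  `R := rateCarriersOfRecord₁₃CoPH 𝔯 F θ hP g₀ os k` from the N14 ∕ N15 ∕ N16-at-β rows of the reading at `(g₀, os, k)`, the four kernel inputs, N18 ∕ N22 at the kernel bundle and the letter row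
  `0 ≤ (ℓ).ρ < 1` ((Kᴿ) §1 + `rfl` on the ρ-slot).
* §2 ★★ `hybridNE7Under_of_kernels_pin_fsc` — per guarded admissible tuple `HybridNE7Under (datumOfRecord₁₃CoPH F N θ hP) END` from: the pin; ONE FSC-keyed binder `hrows` carrying the three
  reading-layer rows at the selector (v4 prefix); tuple-level kernel rows `hs hκ hcr hρ hdec h18 h22`; `h20 h21` ∀-keyed; `h19` FSC-keyed at the spelled `PHolderD4 β`; `hx`.
  ★★ `hybridNE7Under_of_kernels_pin_fsc_of_letters` — the same with N18 ∕ N22 ∕ (5.10) read off def-W1's four letters ((Kᴸ) §1).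
* §3 ★★★ `hybridNE7Under_of_quadruple_pin_fsc_of_letters` — ALL FOUR definer pins (u3 ↦ kernel objects of record, ne3 ↦ RR-1's constant layer at `ℓ₃`, ne2 ↦ dag-n15-c's `c2BgObjects`, ne1 ↦
  dag-n14-w1's top-born unit-scale tower `ne1UnitScale l₀ M Λ hM`): the FSC-keyed reading-layer binder `hrows` DISAPPEARS — N14 ∕ N15 hold outright behind their pins (decided models), N16-at-β is the
  β-uniform proviso ∧ leaf β-slot per guarded family at the constant layer — so K3⁷'s body per guarded admissible tuple costs: four pins + `h16` + def-W1's four kernel letters + `Signs ∕ 0 < κ ∕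
  betaPrime510 4 1 κ ≤ cr ∕ 0 ≤ ρ < 1` + `h20 h21` + the FSC-keyed N19′ face `h19` + `hx`.  THE FULLY-PINNED BILL in v4's keying.

HONEST FRAMING.  COMPOSITE-node bookkeeping BY NAME; a REDUCTION, not a discharge — every row a DISPLAYED HYPOTHESIS inhabited for no family today (K0⁷ OPEN): the reading-layer rows now in print's
scope (tuned sequences, [Balaban1987RG1] Thm 2 p. 259) but still NE1′ ∕ NE2 ∕ NE3-at-β content of nodes N14 ∕ N15 ∕ N16; the kernel letters (finite-volume statements of Bałaban-type SHAPE NOT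
PRINTED as such for d = 4; (1.21)'s existence NOT proved; (5.10) of the limiting kernels = print's claim p. 293); NE7-cluster, K5, the N19′ edge; β and `ℓ.ρ` LETTERS; nothing of Bałaban's asserted or
instantiated; no `Provisos₁₃CoPH` inhabitant claimed; no stub of K3⁷ v4 closed or claimed (NOT `stub_rates13H` ∕ `stub_expansion13H`); N14–N18 ∕ N22 ∕ N27 NOT discharged; skeleton v4 and every
landed decl UNTOUCHED (additive file); counts UNMOVED (typed 28∕28 · discharged 5∕27, A 5∕28); one finite four-torus programme at fixed `ε` — R4 closes the conditional rung `BalabanLadder.UV`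
only: NOT ℝ⁴, NOT infinite volume, NOT OS, NOT a mass gap, NOT Clay.  No decl below carries a cite tag.
-/

set_option autoImplicit false

namespace Summit.QuantumFields.YangMills.Theorems.BalabanUVNodesN27SpineRecord

open scoped Matrix.Norms.L2Operator
open Literature.MathematicalPhysics.QuantumFieldTheory.Balaban1983to89
open Literature.MathematicalPhysics.QuantumFieldTheory.Balaban1983to89.T4Continuum
open Literature.MathematicalPhysics.QuantumFieldTheory.Balaban1983to89.B12Sec2to5 (betaPrime510)
open Literature.MathematicalPhysics.QuantumFieldTheory.Balaban1983to89.Node00.U3OfKernels (objectsOfRecord₁₃ KernelDecayOfRecord₁₃)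
open Literature.MathematicalPhysics.QuantumFieldTheory.Balaban1983to89.Node00.U3KernelLetters (PolLimitsExistOfRecord₁₃ WindowedNE9OfRecord₁₃ WindowedDecayOfRecord₁₃
  WindowedStepRateOfRecord₁₃)
open T4WeightBudget (RelWeightBound)
open T4IndicatorShell (ShellWeightBound)
open T4ContinuumYM4Torus (ForSmallCouplings)
open T4ApexHybrid (HybridNE7Under)
open Summit.QuantumFields.BalabanUV.T4Continuum.Spine
open YMDAG.UVSplit
open Node00 (Stage13HParams datumOfRecord₁₃CoPH U3Letters₁₁)
open Summit.QuantumFields.YangMills.BalabanUVNodes.N16HolderDefs (N16HolderAt)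
open Summit.QuantumFields.YangMills.BalabanUVNodes.SpineRatesHolder (RatesHolderAt)
open Summit.QuantumFields.YangMills.BalabanUVNodes.N19CoreEdgeFSCComposer (keyedGuarded₁₃CoPH_of_keyedFacesP_fsc)
open YMDAG.N14.TopBorn (ne1UnitScale n14At_sourceTower)
open Node00 (NE3Letters₁₁ ne3ConstLayerOfRecord₁₁)
open Summit.QuantumFields.YangMills.BalabanUVNodes.N16HolderRegime (InEndRegimeH)
open Summit.QuantumFields.YangMills.BalabanUVNodes.N16LeafSlotAllTorus (LeafSlotHolderAT n16HolderAt_of_inEndRegimeH_leafSlotHolderAT)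
open Summit.QuantumFields.YangMills.BalabanUVNodes.N15.AtKeyedHome (neZero_blockFactor)
open Summit.QuantumFields.YangMills.BalabanUVNodes.N15.UnitLayerBg (c2BgObjects n15At_c2BgObjects_family)

variable {N : ℕ} [NeZero N]

/-! ## §1 One tuple: v4's `PHolderD4 β` body at the bundle of a kernel-pinned reading from the rows -/

/-- **v4's `PHolderD4 β D R` BODY AT THE RUN-LENGTH-`k` BUNDLE OF A KERNEL-PINNED READING FROM THE ROWS**: `RatesHolderAt D R β ∧ ReadOutAt D R.u3 ∧ (0 ≤ R.u3.ρ ∧ R.u3.ρ < 1)` at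
`D := datumOfRecord₁₃CoPH F N θ hP`, `R := rateCarriersOfRecord₁₃CoPH 𝔯 F θ hP g₀ os k` from the reading's N14 ∕ N15 ∕ N16-at-β rows at `(g₀, os, k)`, the four kernel inputs, N18 ∕ N22 at the kernel bundle
of record and the ρ-letter row `0 ≤ ℓ.ρ < 1` (the bundle's `u3.ρ` IS `ℓ.ρ`, `rfl` along the pin).  Every row a hypothesis. [bookkeeping] -/
theorem pHolderD4Body_rateCarriers_of_kernels_pin (𝔯 : RateReading₁₃CoPH N) {F : T4Family} (θ : Stage13HParams F N) (hP : θ.Provisos₁₃CoPH F N)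
    (g₀ : ℕ → ℝ) (os : List (ULoop F)) (ℓ : U3Letters₁₁) (hpin : (𝔯.lit F θ hP g₀ os).u3 = objectsOfRecord₁₃ F N θ.toStage13Params ℓ) (β : ℝ) (k : ℕ)
    (h14 : N14At (𝔯.ne1 F θ hP g₀ os)) (h15 : N15At (ne2OfRecord₁₁ ((𝔯.lit F θ hP g₀ os).ne2 k))) (h16 : N16HolderAt (ne3OfRecord₁₁ F ((𝔯.lit F θ hP g₀ os).ne3 k)) β)
    (hs : ℓ.Signs) (hκ : 0 < ℓ.κ) (hcr : betaPrime510 4 1 ℓ.κ ≤ ℓ.cr) (hρ : 0 ≤ ℓ.ρ ∧ ℓ.ρ < 1) (hdec : KernelDecayOfRecord₁₃ F N θ.toStage13Params 0 1 ℓ.κ)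
    (h18 : N18At (u3OfRecord₁₃ θ.toStage13Params (objectsOfRecord₁₃ F N θ.toStage13Params ℓ) k))
    (h22 : N22At (u3OfRecord₁₃ θ.toStage13Params (objectsOfRecord₁₃ F N θ.toStage13Params ℓ) k)) :
    RatesHolderAt (datumOfRecord₁₃CoPH F N θ hP) (rateCarriersOfRecord₁₃CoPH 𝔯 F θ hP g₀ os k) β ∧
      ReadOutAt (datumOfRecord₁₃CoPH F N θ hP) (rateCarriersOfRecord₁₃CoPH 𝔯 F θ hP g₀ os k).u3 ∧
      (0 ≤ (rateCarriersOfRecord₁₃CoPH 𝔯 F θ hP g₀ os k).u3.ρ ∧ (rateCarriersOfRecord₁₃CoPH 𝔯 F θ hP g₀ os k).u3.ρ < 1) := by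
  refine ⟨ratesHolderAt_rateCarriers_of_kernels_pin 𝔯 θ hP g₀ os ℓ hpin β k h14 h15 h16 hs hκ hcr hdec h18 h22,
    readOutAt_rateCarriers_of_kernels_pin 𝔯 θ hP g₀ os ℓ hpin hs hκ hcr hdec k, ?_⟩
  rw [rateCarriers_u3_of_kernels_pin 𝔯 θ hP g₀ os ℓ hpin k]
  exact hρ

/-! ## §2 Per guarded admissible tuple: `HybridNE7Under … END` from a kernel-pinned reading in v4's full-prefix keying -/

section FSC

variable (cr : (F : T4Family) → (θ : Stage13HParams F N) → θ.Provisos₁₃CoPH F N → (ℕ → ℝ) → List (ULoop F) → SpineCarriers) (𝔯 : RateReading₁₃CoPH N)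
  (ksel : (F : T4Family) → (θ : Stage13HParams F N) → θ.Provisos₁₃CoPH F N → (ℕ → ℝ) → List (ULoop F) → ℕ)
  (G : ∀ {F : T4Family}, Stage13HParams F N → Prop) (ℓ : (F : T4Family) → Stage13HParams F N → U3Letters₁₁) (s : (F : T4Family) → Stage13HParams F N → ℕ) (β : ℝ)
  (hpin : ∀ (F : T4Family) (θ : Stage13HParams F N) (hP : θ.Provisos₁₃CoPH F N) (g₀ : ℕ → ℝ) (os : List (ULoop F)),
    (𝔯.lit F θ hP g₀ os).u3 = objectsOfRecord₁₃ F N θ.toStage13Params (ℓ F θ))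
  -- THE THREE READING-LAYER ROWS AT THE SELECTOR, IN v4's FULL-PREFIX KEYING (tuned sequences under (B) ∧ END only)
  (hrows : ∀ (F : T4Family) (θ : Stage13HParams F N) (hP : θ.Provisos₁₃CoPH F N), G θ → θ.Admissible F N →
    B16.EndStatementBPrinted (datumOfRecord₁₃CoPH F N θ hP).C → DagBinding.EndpointExistence (datumOfRecord₁₃CoPH F N θ hP).C.toB12 →
      ForSmallCouplings (datumOfRecord₁₃CoPH F N θ hP) fun g₀ => ∀ os : List (ULoop F),
        N14At (𝔯.ne1 F θ hP g₀ os) ∧ N15At (ne2OfRecord₁₁ ((𝔯.lit F θ hP g₀ os).ne2 (ksel F θ hP g₀ os))) ∧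
          N16HolderAt (ne3OfRecord₁₁ F ((𝔯.lit F θ hP g₀ os).ne3 (ksel F θ hP g₀ os))) β)
  -- letter rows of the U3 letter block, per guarded tuple
  (hs : ∀ (F : T4Family) (θ : Stage13HParams F N), θ.Provisos₁₃CoPH F N → G θ → θ.Admissible F N → (ℓ F θ).Signs)
  (hκ : ∀ (F : T4Family) (θ : Stage13HParams F N), θ.Provisos₁₃CoPH F N → G θ → θ.Admissible F N → 0 < (ℓ F θ).κ)
  (hcr : ∀ (F : T4Family) (θ : Stage13HParams F N), θ.Provisos₁₃CoPH F N → G θ → θ.Admissible F N → betaPrime510 4 1 (ℓ F θ).κ ≤ (ℓ F θ).cr)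
  (hρ : ∀ (F : T4Family) (θ : Stage13HParams F N), θ.Provisos₁₃CoPH F N → G θ → θ.Admissible F N → 0 ≤ (ℓ F θ).ρ ∧ (ℓ F θ).ρ < 1)
  -- K5 (∀-keyed, as v4's `KeyedRelWeight ∕ KeyedShellWeight`), the N19′ face under the prefix at the spelled `PHolderD4 β`, the spine-side representation
  (h20 : ∀ (F : T4Family) (θ : Stage13HParams F N) (hP : θ.Provisos₁₃CoPH F N), G θ → θ.Admissible F N → ∀ (g₀ : ℕ → ℝ) (os : List (ULoop F)),
    RelWeightBound (cr F θ hP g₀ os).l₀ (cr F θ hP g₀ os).T (cr F θ hP g₀ os).A (cr F θ hP g₀ os).B (cr F θ hP g₀ os).Bad (cr F θ hP g₀ os).W)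
  (h21 : ∀ (F : T4Family) (θ : Stage13HParams F N) (hP : θ.Provisos₁₃CoPH F N), G θ → θ.Admissible F N → ∀ (g₀ : ℕ → ℝ) (os : List (ULoop F)),
    ShellWeightBound (cr F θ hP g₀ os).l₀ (cr F θ hP g₀ os).T (cr F θ hP g₀ os).A (cr F θ hP g₀ os).B (cr F θ hP g₀ os).shA (cr F θ hP g₀ os).shB (cr F θ hP g₀ os).Wsh)
  (h19 : ∀ (F : T4Family) (θ : Stage13HParams F N) (hP : θ.Provisos₁₃CoPH F N), G θ → θ.Admissible F N →
    B16.EndStatementBPrinted (datumOfRecord₁₃CoPH F N θ hP).C → DagBinding.EndpointExistence (datumOfRecord₁₃CoPH F N θ hP).C.toB12 →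
      ForSmallCouplings (datumOfRecord₁₃CoPH F N θ hP) fun g₀ => ∀ os : List (ULoop F),
        (RatesHolderAt (datumOfRecord₁₃CoPH F N θ hP) (rateCarriersOfRecord₁₃CoPH 𝔯 F θ hP g₀ os (ksel F θ hP g₀ os)) β ∧
            ReadOutAt (datumOfRecord₁₃CoPH F N θ hP) (rateCarriersOfRecord₁₃CoPH 𝔯 F θ hP g₀ os (ksel F θ hP g₀ os)).u3 ∧
            (0 ≤ (rateCarriersOfRecord₁₃CoPH 𝔯 F θ hP g₀ os (ksel F θ hP g₀ os)).u3.ρ ∧ (rateCarriersOfRecord₁₃CoPH 𝔯 F θ hP g₀ os (ksel F θ hP g₀ os)).u3.ρ < 1)) →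
          letI := (cr F θ hP g₀ os).dec
          ∃ δ : ℕ → ℝ, NE7.Core (cr F θ hP g₀ os).l₀ (cr F θ hP g₀ os).vol (cr F θ hP g₀ os).T (cr F θ hP g₀ os).Bad
            (fun K t τ => (cr F θ hP g₀ os).A K t τ - (cr F θ hP g₀ os).shA K t τ) (fun K t τ => (cr F θ hP g₀ os).B K t τ - (cr F θ hP g₀ os).shB K t τ) δ ∧
            Summable δ)
  (hx : ∀ (F : T4Family) (θ : Stage13HParams F N) (hP : θ.Provisos₁₃CoPH F N), G θ → θ.Admissible F N →
    B16.EndStatementBPrinted (datumOfRecord₁₃CoPH F N θ hP).C → DagBinding.EndpointExistence (datumOfRecord₁₃CoPH F N θ hP).C.toB12 →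
      ForSmallCouplings (datumOfRecord₁₃CoPH F N θ hP) fun g₀ => ∀ os : List (ULoop F),
        0 < (cr F θ hP g₀ os).l₀ ∧ 0 < (cr F θ hP g₀ os).vol ∧
        (∀ (K : ℕ) (t : ℝ), |t| ≤ (cr F θ hP g₀ os).l₀ →
          T4GenFunBounds.schemeZ ((datumOfRecord₁₃CoPH F N θ hP).scheme g₀) os ((cr F θ hP g₀ os).K₀ + K) t =
            ∑ τ ∈ (cr F θ hP g₀ os).T K, (cr F θ hP g₀ os).A K t τ) ∧
        (∀ (K : ℕ) (t : ℝ), |t| ≤ (cr F θ hP g₀ os).l₀ →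
          T4GenFunBounds.schemeZ ((datumOfRecord₁₃CoPH F N θ hP).scheme g₀) os ((cr F θ hP g₀ os).K₀ + K + 1) t =
            ∑ τ ∈ (cr F θ hP g₀ os).T K, (cr F θ hP g₀ os).B K t τ))
include hpin hrows hs hκ hcr hρ h20 h21 h19 hx

/-- ★★ **K3⁷'s BODY AT EVERY GUARDED ADMISSIBLE TUPLE FROM A KERNEL-PINNED READING IN v4's FULL-PREFIX KEYING** (dag-n19-w3 `keyedGuarded₁₃CoPH_of_keyedFacesP_fsc` at `rr := fun F θ hP g₀ os ↦
rateCarriersOfRecord₁₃CoPH 𝔯 F θ hP g₀ os (ksel F θ hP g₀ os)` — v4's `rrOfRecord 𝔯 ksel` spelled — and `P := PHolderD4 β` spelled; `hrates` = `hrows` transported by `ForSmallCouplings.mono` through §1 with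
the TUPLE-LEVEL kernel rows): (D4) ⟸ (5.10) `KernelDecayOfRecord₁₃ F N θ 0 1 κ` + `Signs ∕ 0 < κ ∕ betaPrime510 4 1 κ ≤ cr`, N18 ∕ N22 at the kernel bundle (θ-form, every run length), N17 eliminated,
the ρ-letter row.  At `N = 2`, `G :=` the item's guard, `hP := h.toCore` this IS the item's body (leaf = dag-n27-c's).  NOT a discharge; no stub closed. [bookkeeping] -/
theorem hybridNE7Under_of_kernels_pin_fsc
    (hdec : ∀ (F : T4Family) (θ : Stage13HParams F N), θ.Provisos₁₃CoPH F N → G θ → θ.Admissible F N → KernelDecayOfRecord₁₃ F N θ.toStage13Params 0 1 (ℓ F θ).κ)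
    (h18 : ∀ (F : T4Family) (θ : Stage13HParams F N), θ.Provisos₁₃CoPH F N → G θ → θ.Admissible F N → ∀ k : ℕ,
      N18At (u3OfRecord₁₃ θ.toStage13Params (objectsOfRecord₁₃ F N θ.toStage13Params (ℓ F θ)) k))
    (h22 : ∀ (F : T4Family) (θ : Stage13HParams F N), θ.Provisos₁₃CoPH F N → G θ → θ.Admissible F N → ∀ k : ℕ,
      N22At (u3OfRecord₁₃ θ.toStage13Params (objectsOfRecord₁₃ F N θ.toStage13Params (ℓ F θ)) k))
    (F : T4Family) (θ : Stage13HParams F N) (hP : θ.Provisos₁₃CoPH F N) (hG : G θ) (hθ : θ.Admissible F N) :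
    HybridNE7Under (datumOfRecord₁₃CoPH F N θ hP) (DagBinding.EndpointExistence (datumOfRecord₁₃CoPH F N θ hP).C.toB12) :=
  keyedGuarded₁₃CoPH_of_keyedFacesP_fsc cr (fun F θ hP g₀ os => rateCarriersOfRecord₁₃CoPH 𝔯 F θ hP g₀ os (ksel F θ hP g₀ os)) G
    (fun D R => RatesHolderAt D R β ∧ ReadOutAt D R.u3 ∧ (0 ≤ R.u3.ρ ∧ R.u3.ρ < 1)) h20 h21
    (fun F θ hP hG hθ hB hE => (hrows F θ hP hG hθ hB hE).mono fun g₀ h os =>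
      pHolderD4Body_rateCarriers_of_kernels_pin 𝔯 θ hP g₀ os (ℓ F θ) (hpin F θ hP g₀ os) β (ksel F θ hP g₀ os) (h os).1 (h os).2.1 (h os).2.2
        (hs F θ hP hG hθ) (hκ F θ hP hG hθ) (hcr F θ hP hG hθ) (hρ F θ hP hG hθ) (hdec F θ hP hG hθ) (h18 F θ hP hG hθ _) (h22 F θ hP hG hθ _))
    h19 hx F θ hP hG hθ

/-- ★★ **THE SAME WITH THE U3 ROWS READ OFF def-W1's FOUR FINITE-VOLUME KERNEL LETTERS OF RECORD** ((Kᴸ) §1: `PolLimitsExistOfRecord₁₃` · `WindowedNE9OfRecord₁₃ … κ Λ` ·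
`WindowedDecayOfRecord₁₃ … 0 1 κ` · `WindowedStepRateOfRecord₁₃ … s κ θ₅ (C₅·θ₅)` per guarded tuple).  NOT a discharge; no stub closed. [bookkeeping] -/
theorem hybridNE7Under_of_kernels_pin_fsc_of_letters
    (hL : ∀ (F : T4Family) (θ : Stage13HParams F N), θ.Provisos₁₃CoPH F N → G θ → θ.Admissible F N → PolLimitsExistOfRecord₁₃ F N θ.toStage13Params)
    (h9 : ∀ (F : T4Family) (θ : Stage13HParams F N), θ.Provisos₁₃CoPH F N → G θ → θ.Admissible F N → WindowedNE9OfRecord₁₃ F N θ.toStage13Params (ℓ F θ).κ (ℓ F θ).moduli)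
    (hW : ∀ (F : T4Family) (θ : Stage13HParams F N), θ.Provisos₁₃CoPH F N → G θ → θ.Admissible F N → WindowedDecayOfRecord₁₃ F N θ.toStage13Params 0 1 (ℓ F θ).κ)
    (hS : ∀ (F : T4Family) (θ : Stage13HParams F N), θ.Provisos₁₃CoPH F N → G θ → θ.Admissible F N →
      WindowedStepRateOfRecord₁₃ F N θ.toStage13Params (s F θ) (ℓ F θ).κ (ℓ F θ).θ₅ ((ℓ F θ).C₅ * (ℓ F θ).θ₅))
    (F : T4Family) (θ : Stage13HParams F N) (hP : θ.Provisos₁₃CoPH F N) (hG : G θ) (hθ : θ.Admissible F N) :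
    HybridNE7Under (datumOfRecord₁₃CoPH F N θ hP) (DagBinding.EndpointExistence (datumOfRecord₁₃CoPH F N θ hP).C.toB12) :=
  hybridNE7Under_of_kernels_pin_fsc cr 𝔯 ksel G ℓ β hpin hrows hs hκ hcr hρ h20 h21 h19 hx
    (kernelDecayOfRecord₁₃_of_letters_guarded (fun _ θ => G θ) ℓ hL hW) (n18At_kernels_of_letters_guarded (fun _ θ => G θ) ℓ s hL hS)
    (n22At_kernels_of_letters_guarded (fun _ θ => G θ) ℓ hs hL h9) F θ hP hG hθ

end FSC

/-! ## §3 The fully-pinned bill in v4's keying: all four definer pins, the reading-layer FSC binder gone -/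

section Quadruple

variable (cr : (F : T4Family) → (θ : Stage13HParams F N) → θ.Provisos₁₃CoPH F N → (ℕ → ℝ) → List (ULoop F) → SpineCarriers) (𝔯 : RateReading₁₃CoPH N)
  (ksel : (F : T4Family) → (θ : Stage13HParams F N) → θ.Provisos₁₃CoPH F N → (ℕ → ℝ) → List (ULoop F) → ℕ)
  (G : ∀ {F : T4Family}, Stage13HParams F N → Prop) (ℓ : (F : T4Family) → Stage13HParams F N → U3Letters₁₁) (ℓ₃ : T4Family → NE3Letters₁₁)
  (s : (F : T4Family) → Stage13HParams F N → ℕ) {β : ℝ} (hβ0 : 0 ≤ β) (hβ1 : β ≤ 1) {l₀ M Λ : ℝ} (hl₀ : 0 ≤ l₀) (hM : 0 ≤ M) (hΛ : 0 ≤ Λ)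
  {b aS : ℝ} (hb : 0 < b) (haS : 0 < aS) {c35 : ℝ} (hc35 : 0 < c35) (α α' : Fin 4) (p : ℝ)
include hβ0 hβ1 hl₀ hΛ hb haS hc35

/-- ★★★ **THE FULLY-PINNED BILL IN v4's KEYING — K3⁷'s BODY AT EVERY GUARDED ADMISSIBLE TUPLE FROM A QUADRUPLE-PINNED STAGE-13 RATE READING**: node U3 ↦ def-W1's kernel objects of record
(`hpin`), N16's layer ↦ RR-1's constant layer at `ℓ₃` (`hpin3`), N15's layer ↦ dag-n15-c's primitive-carrier family (`hpin2`), NODE O's dressed tower ↦ dag-n14-w1's top-born unit-scale tower of record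
under reading (a) (`hpin1`); then the FSC-keyed reading-layer binder of §2 is DISCHARGED outright behind the pins (N14 ∕ N15 decided models: `n14At_sourceTower`, `n15At_c2BgObjects_family`; N16-at-β from
the β-uniform proviso ∧ the at-keyed leaf β-slot per guarded family, dag-n16-e `n16HolderAt_of_inEndRegimeH_leafSlotHolderAT`), and K3⁷'s body costs EXACTLY: `h16` · def-W1's four kernel letters ·
`Signs ∕ 0 < κ ∕ betaPrime510 4 1 κ ≤ cr ∕ 0 ≤ ρ < 1` · `h20 h21` ∀-keyed · the FSC-keyed N19′ face `h19` at the spelled `PHolderD4 β` · `hx`.  Every row a HYPOTHESIS or a decided MODEL; nothing PROVED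
of Bałaban's; no stub closed; N27 NOT discharged. [bookkeeping] -/
theorem hybridNE7Under_of_quadruple_pin_fsc_of_letters
    (hpin : ∀ (F : T4Family) (θ : Stage13HParams F N) (hP : θ.Provisos₁₃CoPH F N) (g₀ : ℕ → ℝ) (os : List (ULoop F)),
      (𝔯.lit F θ hP g₀ os).u3 = objectsOfRecord₁₃ F N θ.toStage13Params (ℓ F θ))
    (hpin3 : ∀ (F : T4Family) (θ : Stage13HParams F N) (hP : θ.Provisos₁₃CoPH F N) (g₀ : ℕ → ℝ) (os : List (ULoop F)) (k : ℕ),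
      (𝔯.lit F θ hP g₀ os).ne3 k = ne3ConstLayerOfRecord₁₁ F N (ℓ₃ F))
    (hpin2 : ∀ (F : T4Family) (θ : Stage13HParams F N) (hP : θ.Provisos₁₃CoPH F N) (g₀ : ℕ → ℝ) (os : List (ULoop F)) (k : ℕ),
      (𝔯.lit F θ hP g₀ os).ne2 k = haveI := neZero_blockFactor F; c2BgObjects 3 F.hL b aS α α' c35 p)
    (hpin1 : ∀ (F : T4Family) (θ : Stage13HParams F N) (hP : θ.Provisos₁₃CoPH F N) (g₀ : ℕ → ℝ) (os : List (ULoop F)),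
      𝔯.ne1 F θ hP g₀ os = ne1UnitScale l₀ M Λ hM F θ hP g₀ os)
    (h16 : ∀ (F : T4Family), (∃ θ : Stage13HParams F N, θ.Provisos₁₃CoPH F N ∧ G θ ∧ θ.Admissible F N) →
      InEndRegimeH (ne3OfRecord₁₁ F (ne3ConstLayerOfRecord₁₁ F N (ℓ₃ F))) ∧ LeafSlotHolderAT (ne3OfRecord₁₁ F (ne3ConstLayerOfRecord₁₁ F N (ℓ₃ F))) β)
    (hs : ∀ (F : T4Family) (θ : Stage13HParams F N), θ.Provisos₁₃CoPH F N → G θ → θ.Admissible F N → (ℓ F θ).Signs)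
    (hκ : ∀ (F : T4Family) (θ : Stage13HParams F N), θ.Provisos₁₃CoPH F N → G θ → θ.Admissible F N → 0 < (ℓ F θ).κ)
    (hcr : ∀ (F : T4Family) (θ : Stage13HParams F N), θ.Provisos₁₃CoPH F N → G θ → θ.Admissible F N → betaPrime510 4 1 (ℓ F θ).κ ≤ (ℓ F θ).cr)
    (hρ : ∀ (F : T4Family) (θ : Stage13HParams F N), θ.Provisos₁₃CoPH F N → G θ → θ.Admissible F N → 0 ≤ (ℓ F θ).ρ ∧ (ℓ F θ).ρ < 1)
    (hL : ∀ (F : T4Family) (θ : Stage13HParams F N), θ.Provisos₁₃CoPH F N → G θ → θ.Admissible F N → PolLimitsExistOfRecord₁₃ F N θ.toStage13Params)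
    (h9 : ∀ (F : T4Family) (θ : Stage13HParams F N), θ.Provisos₁₃CoPH F N → G θ → θ.Admissible F N → WindowedNE9OfRecord₁₃ F N θ.toStage13Params (ℓ F θ).κ (ℓ F θ).moduli)
    (hW : ∀ (F : T4Family) (θ : Stage13HParams F N), θ.Provisos₁₃CoPH F N → G θ → θ.Admissible F N → WindowedDecayOfRecord₁₃ F N θ.toStage13Params 0 1 (ℓ F θ).κ)
    (hS : ∀ (F : T4Family) (θ : Stage13HParams F N), θ.Provisos₁₃CoPH F N → G θ → θ.Admissible F N →
      WindowedStepRateOfRecord₁₃ F N θ.toStage13Params (s F θ) (ℓ F θ).κ (ℓ F θ).θ₅ ((ℓ F θ).C₅ * (ℓ F θ).θ₅))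
    (h20 : ∀ (F : T4Family) (θ : Stage13HParams F N) (hP : θ.Provisos₁₃CoPH F N), G θ → θ.Admissible F N → ∀ (g₀ : ℕ → ℝ) (os : List (ULoop F)),
      RelWeightBound (cr F θ hP g₀ os).l₀ (cr F θ hP g₀ os).T (cr F θ hP g₀ os).A (cr F θ hP g₀ os).B (cr F θ hP g₀ os).Bad (cr F θ hP g₀ os).W)
    (h21 : ∀ (F : T4Family) (θ : Stage13HParams F N) (hP : θ.Provisos₁₃CoPH F N), G θ → θ.Admissible F N → ∀ (g₀ : ℕ → ℝ) (os : List (ULoop F)),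
      ShellWeightBound (cr F θ hP g₀ os).l₀ (cr F θ hP g₀ os).T (cr F θ hP g₀ os).A (cr F θ hP g₀ os).B (cr F θ hP g₀ os).shA (cr F θ hP g₀ os).shB (cr F θ hP g₀ os).Wsh)
    (h19 : ∀ (F : T4Family) (θ : Stage13HParams F N) (hP : θ.Provisos₁₃CoPH F N), G θ → θ.Admissible F N →
      B16.EndStatementBPrinted (datumOfRecord₁₃CoPH F N θ hP).C → DagBinding.EndpointExistence (datumOfRecord₁₃CoPH F N θ hP).C.toB12 →
        ForSmallCouplings (datumOfRecord₁₃CoPH F N θ hP) fun g₀ => ∀ os : List (ULoop F),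
          (RatesHolderAt (datumOfRecord₁₃CoPH F N θ hP) (rateCarriersOfRecord₁₃CoPH 𝔯 F θ hP g₀ os (ksel F θ hP g₀ os)) β ∧
              ReadOutAt (datumOfRecord₁₃CoPH F N θ hP) (rateCarriersOfRecord₁₃CoPH 𝔯 F θ hP g₀ os (ksel F θ hP g₀ os)).u3 ∧
              (0 ≤ (rateCarriersOfRecord₁₃CoPH 𝔯 F θ hP g₀ os (ksel F θ hP g₀ os)).u3.ρ ∧ (rateCarriersOfRecord₁₃CoPH 𝔯 F θ hP g₀ os (ksel F θ hP g₀ os)).u3.ρ < 1)) →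
            letI := (cr F θ hP g₀ os).dec
            ∃ δ : ℕ → ℝ, NE7.Core (cr F θ hP g₀ os).l₀ (cr F θ hP g₀ os).vol (cr F θ hP g₀ os).T (cr F θ hP g₀ os).Bad
              (fun K t τ => (cr F θ hP g₀ os).A K t τ - (cr F θ hP g₀ os).shA K t τ) (fun K t τ => (cr F θ hP g₀ os).B K t τ - (cr F θ hP g₀ os).shB K t τ) δ ∧
              Summable δ)
    (hx : ∀ (F : T4Family) (θ : Stage13HParams F N) (hP : θ.Provisos₁₃CoPH F N), G θ → θ.Admissible F N →
      B16.EndStatementBPrinted (datumOfRecord₁₃CoPH F N θ hP).C → DagBinding.EndpointExistence (datumOfRecord₁₃CoPH F N θ hP).C.toB12 →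
        ForSmallCouplings (datumOfRecord₁₃CoPH F N θ hP) fun g₀ => ∀ os : List (ULoop F),
          0 < (cr F θ hP g₀ os).l₀ ∧ 0 < (cr F θ hP g₀ os).vol ∧
          (∀ (K : ℕ) (t : ℝ), |t| ≤ (cr F θ hP g₀ os).l₀ →
            T4GenFunBounds.schemeZ ((datumOfRecord₁₃CoPH F N θ hP).scheme g₀) os ((cr F θ hP g₀ os).K₀ + K) t =
              ∑ τ ∈ (cr F θ hP g₀ os).T K, (cr F θ hP g₀ os).A K t τ) ∧
          (∀ (K : ℕ) (t : ℝ), |t| ≤ (cr F θ hP g₀ os).l₀ →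
            T4GenFunBounds.schemeZ ((datumOfRecord₁₃CoPH F N θ hP).scheme g₀) os ((cr F θ hP g₀ os).K₀ + K + 1) t =
              ∑ τ ∈ (cr F θ hP g₀ os).T K, (cr F θ hP g₀ os).B K t τ))
    (F : T4Family) (θ : Stage13HParams F N) (hP : θ.Provisos₁₃CoPH F N) (hG : G θ) (hθ : θ.Admissible F N) :
    HybridNE7Under (datumOfRecord₁₃CoPH F N θ hP) (DagBinding.EndpointExistence (datumOfRecord₁₃CoPH F N θ hP).C.toB12) :=
  hybridNE7Under_of_kernels_pin_fsc_of_letters cr 𝔯 ksel G ℓ s β hpin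
    (fun F θ hP hG hθ _ _ => ForSmallCouplings.of_forall fun g₀ os => by
      refine ⟨?_, ?_, ?_⟩
      · rw [hpin1 F θ hP g₀ os]
        exact n14At_sourceTower hl₀ hM hΛ
      · rw [hpin2 F θ hP g₀ os]
        exact n15At_c2BgObjects_family hb haS hc35 α α' p F
      · rw [hpin3 F θ hP g₀ os]
        exact n16HolderAt_of_inEndRegimeH_leafSlotHolderAT (h16 F ⟨θ, hP, hG, hθ⟩).1 hβ0 hβ1 (h16 F ⟨θ, hP, hG, hθ⟩).2)
    hs hκ hcr hρ h20 h21 h19 hx hL h9 hW hS F θ hP hG hθ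

end Quadruple

end Summit.QuantumFields.YangMills.Theorems.BalabanUVNodesN27SpineRecord
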